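import Summits.ResolutionOfSingularities.ResolutionOfSingularities.Theorems.HilbertSamuelEliminationSigmaMaxModificationsCorridor3SigmaStepDefs
import Literature.AlgebraicGeometry.Resolution.MarkedIdeals
import Literature.AlgebraicGeometry.Resolution.BlowupOffCentre
import HarnessLib

/-!
# [OURS · L1 W4.2] σ-LAYER — `Corridor3SigmaBoundaryDefs`: the BOUNDARY-THREADED σ-state (home (i) of the typer's PRE-CUT NOTE
# 2026-08-27T10:00:13Z), additive over res-D-pv-047's part 1 (`…Corridor3SigmaStepDefs`, p519751 + §5 p520618)

Crux chain w42 (`SigmaMaxModifications`, stmt-ResolutionOfSingularities-18506; conjunct `SigmaMaxModificationsCorridor3`,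
stmt-ResolutionOfSingularities-19249), σ-layer (res-L1-w42-plan-1 RULINGS v3.13-5 (AV) / v3.14-x). Typer res-L1-type-o1 (OURS typer G4; object
«σ_ρ ORACLE TYPING (cost (4a))», RULINGS v3.14-9 (CD)). OURS (cell res-hironaka, slot W4.2); NOT statements of H. Hironaka's manuscript [Hironaka2017]
nor of [CossartJannsenSaito2020] / [Kollar2007]; AI-typed, weaker than expert review. Helper VOCABULARY `--supports stmt-ResolutionOfSingularities-19249
--as helper` (counted 0). Definitions + proved bookkeeping lemmas; NO row is claimed.

## Why (the typer's finding, agreed by res-type-040 10:06:33Z)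

The σ-DESIGN of record at never-isolated W-top corners (res-L1-w42-idea-2 r7, cards K/L: the RANK-OPTIMAL corner rule σ_ρ + max-RANK service) reads
the polyhedron `Δ_E(x) = Δ(f; u_E; y)` in the E-FRAME of the ACCUMULATED BOUNDARY `E` (the exceptional divisors created so far) through `x`. The
σ-state of part 1 — `Sigma.Strategy.step W hW N ν L P C P'` — and the stage oracles of part 1b — `StageOracle.names W hW N ν L S φ t` — carry the
stage `W`, the labels `L`, the cycle state `P` (and the embedded treated part), but NO boundary; and `E` is a datum of the HISTORY `W → X₀`, not of
`W`. This file threads the boundary through the state ADDITIVELY: nothing landed is touched, and every boundary-BLIND strategy embeds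
(`Strategy.withBoundary`, with `Iff.rfl`-grade step transport and chain-level projection lemmas).

## Contents (namespace `…Theorems.SigmaMaxModificationsCorridor3.Sigma`)

* §1 `Boundary W := List W.IdealSheafData` and `Boundary.next E C : Boundary (blowup C)` — the members' STRICT transforms followed by the
  exceptional divisor `C.comap (blowup.π C)` (Kollár Def. 3.65–3.66 shape; the tree's RUN-level twin is `CentreSeq.exceptionalBoundary` /
  `CentreSeq.transformDivisor`, `Literature…KollarTripleSequence`). SNC-ness is NOT enforced by the type (a Prop for whoever needs it).
* §2 `MarkedStageE` (a marked stage + its boundary), `MarkedStageE.init X x E₀`.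
* §3 `StrategyE` (step relation reading `E`), `Strategy.withBoundary σ` (boundary-blind lift), `StrategyE.IsFunctional`, the scoped admissibility
  `IsAdmissibleStrategyOnE 𝒮 N ν σ` (047's two clauses, scope over `(W, L, P, E)`).
* §4 `CanonicalNearStepσE` (one σ-step at the marked points, boundary updated by `Boundary.next`), `ReachesσE`, `InScopeMσE` (from a maximal origin with
  a given INITIAL boundary `E₀`), `MarkedStageE.IsBlownUpσE`, the rows' chain predicates `NoNearChainFromσE` / `NoMovingNearChainFromσE` /
  `NoWaitingChainFromσE`, the `Q`-origin moving row `MaxOriginNoMovingNearChainAtQσE σ p N Q E₀ G` and the W-top core `WtopEvNonIsoMσE σ p Q E₀`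
  (grades `G` read on the underlying marked stage), and the reachable-state scope `StrategyE.ReachableState`.
* §5 TRANSPORT for boundary-blind strategies: `canonicalNearStepσE_withBoundary` (projection, and the boundary IS `E.next C` of the step's centre),
  `CanonicalNearStepσ.exists_lift` (every σ-step lifts, boundary prescribed), `ReachesσE.toMarkedStage`, and the ROW-LEVEL consequence
  `noMovingNearChainFromσE_of_withBoundary` / `noNearChainFromσE_of_withBoundary` («a boundary-blind row proved in part 1's vocabulary holds in the
  boundary-threaded vocabulary for every initial boundary») — the direction the σ-layer consumes. The converse (lifting whole chains) is not needed
  by any row and is left out.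

* §6 (v5; RULING v3.14-37 (JD)) `Boundary.memberTransform C` (THE MEMBER TRANSFORM OF RECORD) and the BODY-AGNOSTIC API of `Boundary.next` (indexed
  members, membership, support laws `V(t I) ⊆ π⁻¹ V(I)`, `t I ≤ Ĩ`, off `V(C)`: `x' ∈ V(t I) ↔ π x' ∈ V(I)`); importers proving through it survive the
  ruled switch to CJS's principal strict transform (a refactor-lane write of this file only).
INITIAL BOUNDARY (honest scoping). Scheme-side the boundary of a run is what the run creates: rows start from `E₀ = []` at the maximal origin unless
a consumer supplies structure (the toric model's coordinate hyperplanes at a torus-fixed origin are EXTRA data, available only in idea-2's certified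
scope — pass them as `E₀`). A boundary-reading strategy (σ_ρ) must say what it does off full-rank E-corners (e.g. follow `Strategy.cjs R`); that is
the instance's business, not this file's.
-/

noncomputable section

set_option linter.dupNamespace false

open CategoryTheory AlgebraicGeometry TopologicalSpace
open Summit.ResolutionOfSingularities.ResolutionOfSingularities.Theorems.CampaignW42
open Literature.AlgebraicGeometry.Resolution Literature.RingTheory.HilbertSamuel

namespace Summit.ResolutionOfSingularities.ResolutionOfSingularities.Theorems.SigmaMaxModificationsCorridor3.Sigma

universe u

/-! ## §1. Boundaries and their update under a blow-up -/

/-- [OURS · L1 W4.2] **A BOUNDARY on the stage `W`**: the ordered list of its members, each an ideal sheaf (the accumulated exceptional divisors,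
in order of creation; Kollár Def. 3.65 shape). No SNC / Cartier condition is built into the type. NOT a statement of the manuscript.
[cite: Kollar2007, Def. 3.65–3.66 (p. 149)] -/
abbrev Boundary (W : Scheme.{u}) : Type u := List W.IdealSheafData

/-- [OURS · L1 W4.2] **THE BOUNDARY AFTER BLOWING UP `C`**: the STRICT transforms of the members (tree `strictTransformIdeal (blowup.π C) C`),
followed by the exceptional divisor `C.comap (blowup.π C)` as the last member («`E_{i+1} = (π_i)_tot^{-1}(E_i)`»; the run-level twin is
`CentreSeq.exceptionalBoundary`). [cite: Kollar2007, Def. 3.65–3.66 (p. 149)] -/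
def Boundary.next {W : Scheme.{u}} (E : Boundary W) (C : W.IdealSheafData) : Boundary (blowup C) :=
  E.map (strictTransformIdeal (blowup.π C) C) ++ [C.comap (blowup.π C)]

/-- One blow-up adds one boundary member. [folklore] -/
@[simp] theorem Boundary.length_next {W : Scheme.{u}} (E : Boundary W) (C : W.IdealSheafData) :
    (E.next C).length = E.length + 1 := by
  simp [Boundary.next]

/-! ## §2. Marked stages with boundary -/

/-- [OURS · L1 W4.2] **A MARKED STAGE WITH BOUNDARY**: a marked stage `(X_n, L, P, x_n)` of the σ-layer together with its boundary `E_n`.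
OURS bookkeeping; NOT a statement of the manuscript. [folklore] -/
structure MarkedStageE : Type (u + 1) extends MarkedStage.{u} where
  /-- the boundary of the stage -/
  E : Boundary W

/-- [OURS · L1 W4.2] The initial marked stage with boundary: `MarkedStage.init X x` with a prescribed initial boundary `E₀` (scheme-side
default `[]`). [folklore] -/
def MarkedStageE.init (X : Scheme.{u}) [IsLocallyNoetherian X] (x : X) (E₀ : Boundary X) : MarkedStageE.{u} :=
  ⟨MarkedStage.init X x, E₀⟩

/-- Unfolding. [folklore] -/
@[simp] theorem MarkedStageE.init_toMarkedStage (X : Scheme.{u}) [IsLocallyNoetherian X] (x : X) (E₀ : Boundary X) :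
    (MarkedStageE.init X x E₀).toMarkedStage = MarkedStage.init X x := rfl

/-- Unfolding. [folklore] -/
@[simp] theorem MarkedStageE.init_E (X : Scheme.{u}) [IsLocallyNoetherian X] (x : X) (E₀ : Boundary X) :
    (MarkedStageE.init X x E₀).E = E₀ := rfl

/-! ## §3. Strategies reading the boundary -/

/-- [OURS · L1 W4.2] **A STRATEGY READING THE BOUNDARY**: the step relation of part 1's `Sigma.Strategy` with one more argument, the boundary
`E` of the stage — «σ allows the step `(L, P, E) ↦ (C, P')` at level `N`, value `ν`, on `W`». The boundary of the next stage is NOT chosen by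
σ: it is `E.next C` (§4). OURS bookkeeping; NOT a statement of the manuscript. [folklore] -/
structure StrategyE : Type (u + 1) where
  /-- «σ allows the step `(L, P, E) ↦ (C, P')` at level `N`, value `ν`, on the stage `W`» -/
  step : ∀ (W : Scheme.{u}), IsLocallyNoetherian W → ℕ → (ℕ → ℕ) → Labelling W → Option (Pending W) → Boundary W →
    (C : W.IdealSheafData) → Option (Pending (blowup C)) → Prop

/-- [OURS · L1 W4.2] **Boundary-blind lift**: a `Sigma.Strategy` read as a `StrategyE` that ignores the boundary (so `Strategy.cjs R` and every
`Strategy.ofStageOracle ω` of part 1b live in the boundary-threaded layer DEFINITIONALLY). [folklore] -/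
def Strategy.withBoundary (σ : Strategy.{u}) : StrategyE.{u} :=
  ⟨fun W hW N ν L P _ C P' => σ.step W hW N ν L P C P'⟩

/-- Unfolding (`Iff.rfl`). [folklore] -/
@[simp] theorem Strategy.withBoundary_step_iff (σ : Strategy.{u}) (W : Scheme.{u}) (hW : IsLocallyNoetherian W) (N : ℕ) (ν : ℕ → ℕ)
    (L : Labelling W) (P : Option (Pending W)) (E : Boundary W) (C : W.IdealSheafData) (P' : Option (Pending (blowup C))) :
    σ.withBoundary.step W hW N ν L P E C P' ↔ σ.step W hW N ν L P C P' :=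
  Iff.rfl

/-- [OURS · L1 W4.2] `σ` is FUNCTIONAL at level `N`, value `ν` (boundary-threaded copy of `Strategy.IsFunctional`): from every state `(W, L, P, E)` at most
one centre, and for it at most one next cycle state. [folklore] -/
def StrategyE.IsFunctional (N : ℕ) (ν : ℕ → ℕ) (σ : StrategyE.{u}) : Prop :=
  ∀ (W : Scheme.{u}) (hW : IsLocallyNoetherian W) (L : Labelling W) (P : Option (Pending W)) (E : Boundary W),
    (∀ (C₁ C₂ : W.IdealSheafData) (P₁ : Option (Pending (blowup C₁))) (P₂ : Option (Pending (blowup C₂))),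
        σ.step W hW N ν L P E C₁ P₁ → σ.step W hW N ν L P E C₂ P₂ → C₁ = C₂) ∧
      ∀ (C : W.IdealSheafData) (P₁ P₂ : Option (Pending (blowup C))),
        σ.step W hW N ν L P E C P₁ → σ.step W hW N ν L P E C P₂ → P₁ = P₂

/-- A functional boundary-blind strategy is functional in the threaded sense. [folklore] -/
theorem Strategy.IsFunctional.withBoundary {N : ℕ} {ν : ℕ → ℕ} {σ : Strategy.{u}} (h : σ.IsFunctional N ν) :
    σ.withBoundary.IsFunctional N ν :=
  fun W hW L P _ => h W hW L P

/-- [OURS · L1 W4.2] **`σ` is ADMISSIBLE ON THE STATE-SCOPE `𝒮`** (boundary-threaded copy of 047's `IsAdmissibleStrategyOn`, the scope reading the boundary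
too): at states in `𝒮`, (a) every allowed step has a PERMISSIBLE centre inside the `ν`-stratum, non-empty while the stratum is; (b) TOTALITY while the
stratum is non-empty. [cite: CossartJannsenSaito2020, Def. 3.1, Rem. 6.29 (1)] -/
def IsAdmissibleStrategyOnE
    (𝒮 : ∀ (W : Scheme.{u}), IsLocallyNoetherian W → Labelling W → Option (Pending W) → Boundary W → Prop)
    (N : ℕ) (ν : ℕ → ℕ) (σ : StrategyE.{u}) : Prop :=
  ∀ (W : Scheme.{u}) (hW : IsLocallyNoetherian W) (L : Labelling W) (P : Option (Pending W)) (E : Boundary W), 𝒮 W hW L P E →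
    (∀ (C : W.IdealSheafData) (P' : Option (Pending (blowup C))), σ.step W hW N ν L P E C P' →
        IdealSheafData.IsPermissible C ∧ (C.support : Set W) ⊆ Scheme.hsStratum W N ν ∧
          ((Scheme.hsStratum W N ν).Nonempty → (C.support : Set W).Nonempty)) ∧
      ((Scheme.hsStratum W N ν).Nonempty →
        ∃ (C : W.IdealSheafData) (P' : Option (Pending (blowup C))), σ.step W hW N ν L P E C P')

/-- Boundary-blind admissibility on a boundary-blind scope is threaded admissibility. [folklore] -/
theorem IsAdmissibleStrategyOn.withBoundary
    {𝒮 : ∀ (W : Scheme.{u}), IsLocallyNoetherian W → Labelling W → Option (Pending W) → Prop} {N : ℕ} {ν : ℕ → ℕ} {σ : Strategy.{u}}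
    (h : IsAdmissibleStrategyOn 𝒮 N ν σ) :
    IsAdmissibleStrategyOnE (fun W hW L P _ => 𝒮 W hW L P) N ν σ.withBoundary :=
  fun W hW L P _ hS => h W hW L P hS

/-! ## §4. σ-steps with boundary, reachability, and the rows' chain predicates -/

/-- [OURS · L1 W4.2] **ONE σ-STEP AT THE MARKED POINTS, BOUNDARY THREADED**: σ names `(C, P')` from the state `(X_n, L, P, E)`; the next marked stage is
`blowup C` with the updated labels, the state `P'`, a CLOSED marked point `x_{n+1} ↦ x_n` in the `ν`-stratum, and the boundary `E.next C`.
NOT a statement of the manuscript. [folklore] -/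
def CanonicalNearStepσE (σ : StrategyE.{u}) (N : ℕ) (ν : ℕ → ℕ) (s s' : MarkedStageE.{u}) : Prop :=
  ∃ (C : s.W.IdealSheafData) (P' : Option (Pending (blowup C))) (h : IsLocallyNoetherian (blowup C))
    (x' : ↥(blowup C)),
    σ.step s.W s.ln N ν s.L s.P s.E C P' ∧ (blowup.π C).base x' = s.pt ∧
      IsClosed ({x'} : Set ↥(blowup C)) ∧ x' ∈ Scheme.hsStratum (blowup C) N ν ∧
      s' = ⟨⟨blowup C, h, s.L.next (Scheme.hsStratum s.W N ν) C, P', x'⟩, s.E.next C⟩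

/-- [OURS · L1 W4.2] reached by finitely many boundary-threaded σ-steps (reflexive–transitive closure). [folklore] -/
def ReachesσE (σ : StrategyE.{u}) (N : ℕ) (ν : ℕ → ℕ) : MarkedStageE.{u} → MarkedStageE.{u} → Prop :=
  Relation.ReflTransGen (CanonicalNearStepσE σ N ν)

/-- [OURS · L1 W4.2] In scope for σ with initial boundary `E₀`: reached along σ from a MAXIMAL origin of characteristic `p` started with the boundary
`E₀ X x` (an initial-boundary ASSIGNMENT; scheme-side default `fun _ _ => []`). [folklore] -/
def InScopeMσE (p : ℕ) (σ : StrategyE.{u}) (N : ℕ) (ν : ℕ → ℕ)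
    (E₀ : ∀ (X : Scheme.{u}), X → Boundary X) (s : MarkedStageE.{u}) : Prop :=
  ∃ (X : Scheme.{u}) (h : IsLocallyNoetherian X) (x : X),
    IsMaximalOrigin p N ν X x ∧ ReachesσE σ N ν ⟨@MarkedStage.init X h x, E₀ X x⟩ s

/-- [OURS · L1 W4.2] THE MARKED POINT IS BLOWN UP under σ at this stage (boundary-threaded copy of `MarkedStage.IsBlownUpσ`). [folklore] -/
def MarkedStageE.IsBlownUpσE (σ : StrategyE.{u}) (N : ℕ) (ν : ℕ → ℕ) (s : MarkedStageE.{u}) : Prop :=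
  ∃ (C : s.W.IdealSheafData) (P' : Option (Pending (blowup C))),
    σ.step s.W s.ln N ν s.L s.P s.E C P' ∧ s.pt ∈ (C.support : Set s.W)

/-- [OURS · L1 W4.2] NO INFINITE σ-NEAR CHAIN FROM `s₀` WITHIN THE GRADE `G` (grades read on the underlying marked stage). [folklore] -/
def NoNearChainFromσE (σ : StrategyE.{u}) (N : ℕ) (ν : ℕ → ℕ) (s₀ : MarkedStageE.{u})
    (G : MarkedStage.{u} → Prop) : Prop :=
  ¬ ∃ c : ℕ → MarkedStageE.{u}, ReachesσE σ N ν s₀ (c 0) ∧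
      (∀ n, CanonicalNearStepσE σ N ν (c n) (c (n + 1))) ∧ ∀ n, G (c n).toMarkedStage

/-- [OURS · L1 W4.2] NO INFINITE MOVING σ-NEAR CHAIN FROM `s₀` WITHIN `G` (marked point blown up infinitely often). [folklore] -/
def NoMovingNearChainFromσE (σ : StrategyE.{u}) (N : ℕ) (ν : ℕ → ℕ) (s₀ : MarkedStageE.{u})
    (G : MarkedStage.{u} → Prop) : Prop :=
  ¬ ∃ c : ℕ → MarkedStageE.{u}, ReachesσE σ N ν s₀ (c 0) ∧
      (∀ n, CanonicalNearStepσE σ N ν (c n) (c (n + 1))) ∧ (∀ n, G (c n).toMarkedStage) ∧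
      ∀ n, ∃ m, n ≤ m ∧ (c m).IsBlownUpσE σ N ν

/-- [OURS · L1 W4.2] NO ETERNALLY WAITING σ-CHAIN FROM `s₀` (marked point never blown up). [folklore] -/
def NoWaitingChainFromσE (σ : StrategyE.{u}) (N : ℕ) (ν : ℕ → ℕ) (s₀ : MarkedStageE.{u}) : Prop :=
  ¬ ∃ c : ℕ → MarkedStageE.{u}, ReachesσE σ N ν s₀ (c 0) ∧
      (∀ n, CanonicalNearStepσE σ N ν (c n) (c (n + 1))) ∧ ∀ n, ¬ (c n).IsBlownUpσE σ N ν

/-- [OURS · L1 W4.2] **THE MOVING ROW AT `Q`-ORIGINS FOR A BOUNDARY-READING σ**, started with the initial-boundary assignment `E₀`. [folklore] -/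
def MaxOriginNoMovingNearChainAtQσE (σ : StrategyE.{u}) (p N : ℕ) (Q : ℕ → (ℕ → ℕ) → ∀ X : Scheme.{u}, X → Prop)
    (E₀ : ∀ (X : Scheme.{u}), X → Boundary X) (G : MarkedStage.{u} → Prop) : Prop :=
  ∀ (ν : ℕ → ℕ) (X : Scheme.{u}) [IsLocallyNoetherian X] (x : X), IsMaximalOrigin p N ν X x → Q N ν X x →
    NoMovingNearChainFromσE σ N ν (MarkedStageE.init X x (E₀ X x)) G

/-- [OURS · L1 W4.2] **Ev-NonIso FOR A BOUNDARY-READING σ** (copy of `WtopEvNonIsoMσ`): no moving σ-chain of grade `ē ≥ 3` with no isolated stage, from a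
`Q`-maximal origin at level `3`, started with `E₀`. [folklore] -/
def WtopEvNonIsoMσE (σ : StrategyE.{u}) (p : ℕ) (Q : ℕ → (ℕ → ℕ) → ∀ X : Scheme.{u}, X → Prop)
    (E₀ : ∀ (X : Scheme.{u}), X → Boundary X) : Prop :=
  MaxOriginNoMovingNearChainAtQσE σ p 3 Q E₀ fun s => 3 ≤ s.geomDirDim ∧ ¬ Moving.Iso 3 s

/-- [OURS · L1 W4.2] **The reachable-state scope, boundary threaded** (047's §5 rule (CC) in this layer): the state `(W, L, P, E)` is carried by a marked
stage with boundary σ-reachable from a characteristic-`p` maximal origin started with `E₀`. [folklore] -/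
def StrategyE.ReachableState (p : ℕ) (σ : StrategyE.{u}) (N : ℕ) (ν : ℕ → ℕ) (E₀ : ∀ (X : Scheme.{u}), X → Boundary X) :
    ∀ (W : Scheme.{u}), IsLocallyNoetherian W → Labelling W → Option (Pending W) → Boundary W → Prop :=
  fun W hW L P E => ∃ x : W, InScopeMσE p σ N ν E₀ ⟨⟨W, hW, L, P, x⟩, E⟩

/-! ## §5. Transport for boundary-blind strategies (the direction the rows consume) -/

section Transport

variable {σ : Strategy.{u}} {N : ℕ} {ν : ℕ → ℕ}

/-- **A boundary-threaded step of a boundary-blind strategy IS a σ-step of the underlying marked stages, and the new boundary is `E.next C` for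
its centre.** [folklore] -/
theorem CanonicalNearStepσE.toMarkedStage {s s' : MarkedStageE.{u}} (h : CanonicalNearStepσE σ.withBoundary N ν s s') :
    CanonicalNearStepσ σ N ν s.toMarkedStage s'.toMarkedStage := by
  obtain ⟨C, P', hln, x', hstep, hπ, hcl, hx', rfl⟩ := h
  exact ⟨C, P', hln, x', hstep, hπ, hcl, hx', rfl⟩

/-- **Every σ-step of the underlying marked stage LIFTS** to a boundary-threaded step, the boundary being prescribed (`E.next C`). [folklore] -/
theorem CanonicalNearStepσ.exists_liftE {s : MarkedStageE.{u}} {t : MarkedStage.{u}} (h : CanonicalNearStepσ σ N ν s.toMarkedStage t) :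
    ∃ s' : MarkedStageE.{u}, s'.toMarkedStage = t ∧ CanonicalNearStepσE σ.withBoundary N ν s s' := by
  obtain ⟨C, P', hln, x', hstep, hπ, hcl, hx', rfl⟩ := h
  exact ⟨⟨⟨blowup C, hln, s.L.next (Scheme.hsStratum s.W N ν) C, P', x'⟩, s.E.next C⟩, rfl,
    C, P', hln, x', hstep, hπ, hcl, hx', rfl⟩

/-- Reachability projects to the underlying marked stages. [folklore] -/
theorem ReachesσE.toMarkedStage {s s' : MarkedStageE.{u}} (h : ReachesσE σ.withBoundary N ν s s') :
    Reachesσ σ N ν s.toMarkedStage s'.toMarkedStage := by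
  induction h with
  | refl => exact Relation.ReflTransGen.refl
  | tail _ hlast ih => exact ih.tail hlast.toMarkedStage

/-- Blown-up marked points project. [folklore] -/
theorem MarkedStageE.IsBlownUpσE.toMarkedStage {s : MarkedStageE.{u}} (h : s.IsBlownUpσE σ.withBoundary N ν) :
    s.toMarkedStage.IsBlownUpσ σ N ν := by
  obtain ⟨C, P', hstep, hpt⟩ := h
  exact ⟨C, P', hstep, hpt⟩

/-- … and conversely (the boundary plays no role in a boundary-blind step). [folklore] -/
theorem MarkedStageE.isBlownUpσE_withBoundary_iff (s : MarkedStageE.{u}) :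
    s.IsBlownUpσE σ.withBoundary N ν ↔ s.toMarkedStage.IsBlownUpσ σ N ν :=
  ⟨fun h => h.toMarkedStage, fun ⟨C, P', hstep, hpt⟩ => ⟨C, P', hstep, hpt⟩⟩

/-- In-scope stages project (initial boundary forgotten). [folklore] -/
theorem InScopeMσE.toMarkedStage {p : ℕ} {E₀ : ∀ (X : Scheme.{u}), X → Boundary X} {s : MarkedStageE.{u}}
    (h : InScopeMσE p σ.withBoundary N ν E₀ s) : InScopeMσ p σ N ν s.toMarkedStage := by
  obtain ⟨X, hX, x, horig, hreach⟩ := h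
  exact ⟨X, hX, x, horig, hreach.toMarkedStage⟩

/-- **ROW TRANSPORT (no near chain)**: a boundary-blind row in part 1's vocabulary gives the boundary-threaded row, for every initial boundary.
[folklore] -/
theorem noNearChainFromσE_of_withBoundary {s₀ : MarkedStageE.{u}} {G : MarkedStage.{u} → Prop}
    (h : NoNearChainFromσ σ N ν s₀.toMarkedStage G) : NoNearChainFromσE σ.withBoundary N ν s₀ G := by
  rintro ⟨c, h0, hstep, hG⟩
  exact h ⟨fun n => (c n).toMarkedStage, h0.toMarkedStage, fun n => (hstep n).toMarkedStage, hG⟩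

/-- **ROW TRANSPORT (no moving near chain)**. [folklore] -/
theorem noMovingNearChainFromσE_of_withBoundary {s₀ : MarkedStageE.{u}} {G : MarkedStage.{u} → Prop}
    (h : NoMovingNearChainFromσ σ N ν s₀.toMarkedStage G) : NoMovingNearChainFromσE σ.withBoundary N ν s₀ G := by
  rintro ⟨c, h0, hstep, hG, hmov⟩
  refine h ⟨fun n => (c n).toMarkedStage, h0.toMarkedStage, fun n => (hstep n).toMarkedStage, hG, fun n => ?_⟩
  obtain ⟨m, hm, hbu⟩ := hmov n
  exact ⟨m, hm, hbu.toMarkedStage⟩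

/-- **ROW TRANSPORT (no waiting chain)**. [folklore] -/
theorem noWaitingChainFromσE_of_withBoundary {s₀ : MarkedStageE.{u}}
    (h : NoWaitingChainFromσ σ N ν s₀.toMarkedStage) : NoWaitingChainFromσE σ.withBoundary N ν s₀ := by
  rintro ⟨c, h0, hstep, hwait⟩
  refine h ⟨fun n => (c n).toMarkedStage, h0.toMarkedStage, fun n => (hstep n).toMarkedStage, fun n hbu => ?_⟩
  exact hwait n ((MarkedStageE.isBlownUpσE_withBoundary_iff _).mpr hbu)

/-- **ROW TRANSPORT at `Q`-origins**: `MaxOriginNoMovingNearChainAtQσ σ p N Q G` gives the boundary-threaded row for `σ.withBoundary` and EVERY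
initial-boundary assignment. [folklore] -/
theorem maxOriginNoMovingNearChainAtQσE_of_withBoundary {p : ℕ} {Q : ℕ → (ℕ → ℕ) → ∀ X : Scheme.{u}, X → Prop}
    {G : MarkedStage.{u} → Prop} (h : MaxOriginNoMovingNearChainAtQσ σ p N Q G) (E₀ : ∀ (X : Scheme.{u}), X → Boundary X) :
    MaxOriginNoMovingNearChainAtQσE σ.withBoundary p N Q E₀ G :=
  fun ν X _ x hX hQ => noMovingNearChainFromσE_of_withBoundary (h ν X x hX hQ)

/-- **ROW TRANSPORT, W-top core**: `WtopEvNonIsoMσ σ p Q → WtopEvNonIsoMσE σ.withBoundary p Q E₀`. [folklore] -/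
theorem wtopEvNonIsoMσE_of_withBoundary {p : ℕ} {Q : ℕ → (ℕ → ℕ) → ∀ X : Scheme.{u}, X → Prop}
    (h : WtopEvNonIsoMσ σ p Q) (E₀ : ∀ (X : Scheme.{u}), X → Boundary X) : WtopEvNonIsoMσE σ.withBoundary p Q E₀ :=
  maxOriginNoMovingNearChainAtQσE_of_withBoundary h E₀

/-- **SCOPE TRANSPORT**: a boundary-threaded reachable state of `σ.withBoundary` is a reachable state of `σ` (so 047's (CC)-scoped admissibility of `σ`
gives the threaded one on the threaded reachable scope, `IsAdmissibleStrategyOn.withBoundary_reachable`). [folklore] -/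
theorem StrategyE.reachableState_withBoundary {p : ℕ} {E₀ : ∀ (X : Scheme.{u}), X → Boundary X} {W : Scheme.{u}}
    {hW : IsLocallyNoetherian W} {L : Labelling W} {P : Option (Pending W)} {E : Boundary W}
    (h : StrategyE.ReachableState p σ.withBoundary N ν E₀ W hW L P E) : Strategy.ReachableState p σ N ν W hW L P := by
  obtain ⟨x, hx⟩ := h
  exact ⟨x, hx.toMarkedStage⟩

/-- 047's reachable-scope admissibility of a boundary-blind `σ` gives threaded admissibility on the threaded reachable scope, every `E₀`. [folklore] -/
theorem IsAdmissibleStrategyOn.withBoundary_reachable {p : ℕ} (h : IsAdmissibleStrategyOn (Strategy.ReachableState p σ N ν) N ν σ)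
    (E₀ : ∀ (X : Scheme.{u}), X → Boundary X) :
    IsAdmissibleStrategyOnE (StrategyE.ReachableState p σ.withBoundary N ν E₀) N ν σ.withBoundary :=
  fun W hW L P _ hS => h W hW L P (StrategyE.reachableState_withBoundary hS)

end Transport

/-! ## §6. The member transform of record and the body-agnostic API of `Boundary.next` (v5) -/

section MemberTransform

variable {W : Scheme.{u}}

/-- [OURS · L1 W4.2] **THE MEMBER TRANSFORM OF RECORD** under the blow-up of `C` (what `Boundary.next` applies to old members). CURRENT body: the
scheme-theoretic strict transform; OF RECORD (RULING v3.14-37 (JD), 2026-08-27): CJS's `principalStrictTransform (blowup.π C) C` (LNM 2270 Def. 5.5) — a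
switch of THIS body, refactor lane only. Prove through this section's API and the switch does not touch you. NOT a statement of the manuscript. [folklore] -/
def Boundary.memberTransform (C : W.IdealSheafData) : W.IdealSheafData → (blowup C).IdealSheafData :=
  strictTransformIdeal (blowup.π C) C

/-- **`Boundary.next` THROUGH THE MEMBER TRANSFORM**: the transforms of the old members, in order, then the exceptional divisor. [folklore] -/
theorem Boundary.next_eq_map_memberTransform (E : Boundary W) (C : W.IdealSheafData) :
    E.next C = E.map (Boundary.memberTransform C) ++ [C.comap (blowup.π C)] :=
  rfl

/-- An old-index member of `E.next C` is the transform of the corresponding member of `E`. [folklore] -/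
theorem Boundary.getElem_next_of_lt (E : Boundary W) (C : W.IdealSheafData) {m : ℕ} (hm : m < E.length)
    (hm' : m < (E.next C).length := by simp; omega) : (E.next C)[m] = Boundary.memberTransform C E[m] := by
  simp only [Boundary.next_eq_map_memberTransform]
  rw [List.getElem_append_left (by simpa using hm), List.getElem_map]

/-- Membership in `E.next C`: a transform of an old member, or the exceptional divisor. [folklore] -/
theorem Boundary.mem_next_iff (E : Boundary W) (C : W.IdealSheafData) (J : (blowup C).IdealSheafData) :
    J ∈ E.next C ↔ (∃ I ∈ E, Boundary.memberTransform C I = J) ∨ J = C.comap (blowup.π C) := by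
  simp [Boundary.next_eq_map_memberTransform, List.mem_append, List.mem_map]

/-- **Law 1 (ideals)**: `π^* I ≤ t I` (true for the saturation and for the principal strict transform alike). [folklore] -/
theorem Boundary.comap_le_memberTransform (C I : W.IdealSheafData) : I.comap (blowup.π C) ≤ Boundary.memberTransform C I :=
  (comap_le_controlledTransform (blowup.π C) C I 0).trans (controlledTransform_le_strictTransformIdeal (blowup.π C) C I 0)

/-- **Law 2 (ideals)**: `t I ≤ Ĩ` (so `V(Ĩ) ⊆ V(t I)`; CJS Rem. 5.6 (a) `B̃ ↪ B'` for the principal transform, equality for the current body). [folklore] -/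
theorem Boundary.memberTransform_le_strictTransformIdeal (C I : W.IdealSheafData) :
    Boundary.memberTransform C I ≤ strictTransformIdeal (blowup.π C) C I :=
  le_rfl

/-- **Law 1 (supports)**: the new member lies over the old one, `V(t I) ⊆ π⁻¹ V(I)`. [folklore] -/
theorem Boundary.support_memberTransform_subset (C I : W.IdealSheafData) :
    ((Boundary.memberTransform C I).support : Set ↥(blowup C)) ⊆ (blowup.π C).base ⁻¹' (I.support : Set W) := by
  intro x' hx'
  have h := Scheme.IdealSheafData.support_antitone (Boundary.comap_le_memberTransform C I) hx'
  rw [Scheme.IdealSheafData.support_comap] at h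
  exact h

/-- **Law 3 — OFF `V(C)` the member transform is the total transform, support-wise**: `x' ∈ V(t I) ↔ π x' ∈ V(I)`. [cite: GortzWedhorn2020, (13.19) p. 414] -/
theorem Boundary.mem_support_memberTransform_iff_of_not_mem [IsLocallyNoetherian W] (C I : W.IdealSheafData) [IsLocallyNoetherian (blowup C)]
    {x' : ↥(blowup C)} (hx' : (blowup.π C).base x' ∉ (C.support : Set W)) :
    x' ∈ ((Boundary.memberTransform C I).support : Set ↥(blowup C)) ↔ (blowup.π C).base x' ∈ (I.support : Set W) := by
  have h1 : x' ∈ ((Boundary.memberTransform C I).support : Set ↥(blowup C)) ↔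
      x' ∈ ((I.comap (blowup.π C)).support : Set ↥(blowup C)) := by
    simp only [SetLike.mem_coe]
    rw [mem_support_iff_stalkIdeal_le, mem_support_iff_stalkIdeal_le, Boundary.memberTransform,
      (blowup.isBlowup C).stalkIdeal_strictTransformIdeal_of_not_mem I hx']
  rw [h1, SetLike.mem_coe, Scheme.IdealSheafData.support_comap]
  rfl

/-- **OFF `V(C)` the members of `E.next C` through `x'` are, in order, the transforms of the members of `E` through `π x'`.** [folklore] -/
theorem Boundary.filter_next_of_not_mem [IsLocallyNoetherian W] (E : Boundary W) (C : W.IdealSheafData) [IsLocallyNoetherian (blowup C)]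
    {x' : ↥(blowup C)} (hx' : (blowup.π C).base x' ∉ (C.support : Set W))
    [DecidablePred fun J : (blowup C).IdealSheafData => x' ∈ (J.support : Set ↥(blowup C))]
    [DecidablePred fun I : W.IdealSheafData => (blowup.π C).base x' ∈ (I.support : Set W)] :
    (E.next C).filter (fun J => x' ∈ (J.support : Set ↥(blowup C))) =
      (E.filter fun I => (blowup.π C).base x' ∈ (I.support : Set W)).map (Boundary.memberTransform C) := by
  have hlast : decide (x' ∈ ((C.comap (blowup.π C)).support : Set ↥(blowup C))) = false :=
    decide_eq_false fun h => hx' (by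
      rw [SetLike.mem_coe, Scheme.IdealSheafData.support_comap] at h
      exact h)
  rw [Boundary.next_eq_map_memberTransform, List.filter_append, List.filter_singleton, hlast, cond_false, List.append_nil,
    List.filter_map]
  congr 1
  exact List.filter_congr fun I _ => by
    simp only [Function.comp_apply, decide_eq_decide]
    exact Boundary.mem_support_memberTransform_iff_of_not_mem C I hx'

end MemberTransform

end Summit.ResolutionOfSingularities.ResolutionOfSingularities.Theorems.SigmaMaxModificationsCorridor3.Sigma

end
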